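import Mathlib
import Summits.AnomalousDissipation.AnomalousDissipation.Theorems.SoloBlindTuningRigidity

/-!
# SoloBlind — tightness of the tuning-rigidity theorem: without `NoWindowJump` there is no fat block

Kernel #73 (`SoloBlindTuningRigidity.fat_block`) derives a FAT BLOCK (a run of `L` consecutive leaves all
sped up by at least `us`, or all slowed by at least `us`, with `3L + 2⌈2us/δ⌉ ≥ N + 1`) from two
hypotheses on the leaf speed-up sequence `u`: window avoidance `OffWindow u N us δ` (every leaf that is
not a fat slow-down carries a tuned step `|leafStep u j| ≥ δ`) and `NoWindowJump u N δ` (adjacent steps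
differ by less than `δ`).  The s40 numerics (1-D front toy of the reduced thin-box model, paper §24.20)
show steady states that are tuned leaf by leaf but whose shear CROSSES the window inside thin layers:
blocks of positively tuned leaves separated by single leaves of large negative step, so that the
speed-up `u` never accumulates.  This file certifies that such configurations defeat the conclusion:

* `saw δ` (steps `+δ, −δ, +δ, …`) and `layered δ L` (`L` steps `+δ`, then one step `−Lδ`, repeated)
  satisfy `OffWindow` for every `N` and every `us`, have `|u j| ≤ Lδ` (resp. `≤ δ`) for all `j`,
  violate `NoWindowJump`, and admit NO fat block once `us` exceeds that bound and `N` is large;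
* hence `OffWindow` alone does not imply the fat-block alternative (`offWindow_not_sufficient`):
  the hypothesis `NoWindowJump` of #73 is necessary, and it is exactly what the layered states break.

Finite sequences only; no analysis.
-/

namespace Summit.AnomalousDissipation.AnomalousDissipation.Theorems

/-- The alternating sawtooth `0, δ, 0, δ, …`. -/
noncomputable def saw (δ : ℝ) : ℕ → ℝ := fun j => if j % 2 = 0 then 0 else δ

/-- The sawtooth is nonnegative. -/
theorem saw_nonneg {δ : ℝ} (hδ : 0 ≤ δ) (j : ℕ) : 0 ≤ saw δ j := by
  unfold saw; split_ifs <;> linarith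

/-- The sawtooth is bounded by `δ`. -/
theorem saw_le {δ : ℝ} (hδ : 0 ≤ δ) (j : ℕ) : saw δ j ≤ δ := by
  unfold saw; split_ifs <;> linarith

/-- `|saw δ j| ≤ δ`. -/
theorem saw_abs_le {δ : ℝ} (hδ : 0 ≤ δ) (j : ℕ) : |saw δ j| ≤ δ := by
  rw [abs_le]; exact ⟨by linarith [saw_nonneg hδ j], saw_le hδ j⟩

/-- Every step of the sawtooth is `+δ` or `−δ`. -/
theorem saw_step (δ : ℝ) (j : ℕ) : leafStep (saw δ) j = δ ∨ leafStep (saw δ) j = -δ := by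
  unfold leafStep saw
  rcases Nat.mod_two_eq_zero_or_one j with h | h
  · have h1 : (j + 1) % 2 = 1 := by omega
    left; simp [h, h1]
  · have h1 : (j + 1) % 2 = 0 := by omega
    right; simp [h, h1]

/-- Two consecutive steps of the sawtooth have opposite signs. -/
theorem saw_step_succ (δ : ℝ) (j : ℕ) : leafStep (saw δ) (j + 1) = -leafStep (saw δ) j := by
  unfold leafStep saw
  rcases Nat.mod_two_eq_zero_or_one j with h | h
  · have h1 : (j + 1) % 2 = 1 := by omega
    have h2 : (j + 1 + 1) % 2 = 0 := by omega
    simp [h, h1, h2]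
  · have h1 : (j + 1) % 2 = 0 := by omega
    have h2 : (j + 1 + 1) % 2 = 1 := by omega
    simp [h, h1, h2]

/-- The sawtooth is window-avoiding for every `N` and every `us`: each step is tuned. -/
theorem saw_offWindow (δ us : ℝ) (N : ℕ) : OffWindow (saw δ) N us δ := by
  intro j _ _
  rcases saw_step δ j with h | h
  · left; rw [h]
  · right; rw [h]

/-- … but it jumps across the window between any two consecutive leaves. -/
theorem saw_windowJump {δ : ℝ} (hδ : 0 < δ) {N : ℕ} (hN : 2 ≤ N) : ¬ NoWindowJump (saw δ) N δ := by
  intro h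
  have h0 := h 0 (by omega)
  rw [saw_step_succ] at h0
  rcases saw_step δ 0 with hs | hs <;> rw [hs] at h0
  · have : |(-δ) - δ| = 2 * δ := by
      rw [show (-δ) - δ = -(2 * δ) by ring, abs_neg, abs_of_pos (by linarith)]
    linarith [this ▸ h0]
  · have : |(- -δ) - -δ| = 2 * δ := by
      rw [show (- -δ) - -δ = 2 * δ by ring, abs_of_pos (by linarith)]
    linarith [this ▸ h0]

/-- The fat-block alternative of #73, as a predicate on `(u, N, us, δ)`. -/
def FatBlock (u : ℕ → ℝ) (N : ℕ) (us δ : ℝ) : Prop :=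
  ∃ a L : ℕ, a + L ≤ N + 1 ∧ ((N : ℝ) + 1 ≤ 3 * L + 2 * (⌈2 * us / δ⌉₊ : ℕ)) ∧
    ((∀ j, a ≤ j → j < a + L → us ≤ u j) ∨ (∀ j, a ≤ j → j < a + L → u j ≤ -us))

/-- #73 restated: `OffWindow ∧ NoWindowJump ⇒ FatBlock`. -/
theorem fatBlock_of_rigidity {u : ℕ → ℝ} {N : ℕ} {us δ : ℝ}
    (hW : OffWindow u N us δ) (hC : NoWindowJump u N δ) (hδ : 0 < δ) : FatBlock u N us δ :=
  fat_block hW hC hδ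

/-- A sequence bounded by `|u j| < us` has no fat block once `N + 1 > 2⌈2us/δ⌉`. -/
theorem no_fatBlock_of_small {u : ℕ → ℝ} {N : ℕ} {us δ : ℝ}
    (hsmall : ∀ j, |u j| < us) (hN : 2 * (⌈2 * us / δ⌉₊ : ℕ) < N + 1) : ¬ FatBlock u N us δ := by
  rintro ⟨a, L, _, hcount, hblk⟩
  rcases Nat.eq_zero_or_pos L with hL | hL
  · subst hL
    have : ((N : ℝ) + 1) ≤ 2 * (⌈2 * us / δ⌉₊ : ℕ) := by simpa using hcount
    have h2 : (2 * (⌈2 * us / δ⌉₊ : ℕ) : ℝ) < (N : ℝ) + 1 := by exact_mod_cast hN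
    linarith
  · have ha := hsmall a
    rw [abs_lt] at ha
    rcases hblk with h | h
    · have := h a le_rfl (by omega); linarith [ha.2]
    · have := h a le_rfl (by omega); linarith [ha.1]

/-- TIGHTNESS OF #73.  For `0 < δ < us` and every `N` with `2 ≤ N` and `N + 1 > 2⌈2us/δ⌉` there is a
leaf sequence that is window-avoiding, uniformly small (`|u j| ≤ δ < us`), jumps across the window, and
has no fat block: `OffWindow` alone does not give the fat-block alternative. -/
theorem offWindow_not_sufficient {us δ : ℝ} (hδ : 0 < δ) (hus : δ < us) {N : ℕ} (hN2 : 2 ≤ N)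
    (hN : 2 * (⌈2 * us / δ⌉₊ : ℕ) < N + 1) :
    ∃ u : ℕ → ℝ, OffWindow u N us δ ∧ (∀ j, |u j| ≤ δ) ∧ ¬ NoWindowJump u N δ ∧ ¬ FatBlock u N us δ :=
  ⟨saw δ, saw_offWindow δ us N, saw_abs_le hδ.le, saw_windowJump hδ hN2,
    no_fatBlock_of_small (fun j => lt_of_le_of_lt (saw_abs_le hδ.le j) hus) hN⟩

/-! ## The layered configuration: blocks of `L` tuned leaves separated by one crossing leaf -/

/-- `layered δ L j = δ · (j mod (L+1))`: climbs `0, δ, …, Lδ` and resets. -/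
noncomputable def layered (δ : ℝ) (L : ℕ) : ℕ → ℝ := fun j => δ * ((j % (L + 1) : ℕ) : ℝ)

/-- The layered sequence is nonnegative. -/
theorem layered_nonneg {δ : ℝ} (hδ : 0 ≤ δ) (L j : ℕ) : 0 ≤ layered δ L j := by
  unfold layered; positivity

/-- The layered sequence never exceeds the block height `δL`. -/
theorem layered_le {δ : ℝ} (hδ : 0 ≤ δ) (L j : ℕ) : layered δ L j ≤ δ * L := by
  unfold layered
  have : ((j % (L + 1) : ℕ) : ℝ) ≤ L := by
    have := Nat.mod_lt j (Nat.succ_pos L)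
    exact_mod_cast Nat.lt_succ_iff.mp this
  exact mul_le_mul_of_nonneg_left this hδ

/-- `|layered δ L j| ≤ δL`. -/
theorem layered_abs_le {δ : ℝ} (hδ : 0 ≤ δ) (L j : ℕ) : |layered δ L j| ≤ δ * L := by
  rw [abs_of_nonneg (layered_nonneg hδ L j)]; exact layered_le hδ L j

/-- Each step of the layered sequence is `+δ` (inside a block) or `−Lδ` (the crossing leaf). -/
theorem layered_step (δ : ℝ) {L : ℕ} (hL : 1 ≤ L) (j : ℕ) :
    leafStep (layered δ L) j = δ ∨ leafStep (layered δ L) j = -(δ * L) := by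
  unfold leafStep layered
  have hlt : j % (L + 1) < L + 1 := Nat.mod_lt j (by omega)
  have hne : L + 1 ≠ 1 := by omega
  have key : (j + 1) % (L + 1) = (j % (L + 1) + 1) % (L + 1) := by
    rw [Nat.add_mod, Nat.one_mod_eq_one.mpr hne]
  by_cases h : j % (L + 1) = L
  · -- reset step
    right
    have h1 : (j + 1) % (L + 1) = 0 := by rw [key, h, Nat.mod_self]
    rw [h1, h]; push_cast; ring
  · left
    have h2 : j % (L + 1) + 1 < L + 1 := by omega
    have h1 : (j + 1) % (L + 1) = j % (L + 1) + 1 := by rw [key, Nat.mod_eq_of_lt h2]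
    rw [h1]; push_cast; ring

/-- The layered sequence is window-avoiding for every `N` and `us` (each step is `+δ` or `≤ −δ`). -/
theorem layered_offWindow (δ us : ℝ) {L : ℕ} (hL : 1 ≤ L) (hδ : 0 ≤ δ) (N : ℕ) :
    OffWindow (layered δ L) N us δ := by
  intro j _ _
  rcases layered_step δ hL j with h | h
  · left; rw [h]
  · right; rw [h]
    have : δ * 1 ≤ δ * L := mul_le_mul_of_nonneg_left (by exact_mod_cast hL) hδ
    linarith

/-- The crossing leaf is a window jump: at `j = L − 1` the step goes from `+δ` to `−Lδ`. -/
theorem layered_windowJump {δ : ℝ} (hδ : 0 < δ) {L : ℕ} (hL : 1 ≤ L) {N : ℕ} (hN : L + 1 ≤ N) :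
    ¬ NoWindowJump (layered δ L) N δ := by
  intro h
  have hj := h (L - 1) (by omega)
  have hs1 : leafStep (layered δ L) (L - 1) = δ := by
    unfold leafStep layered
    have e1 : (L - 1) % (L + 1) = L - 1 := Nat.mod_eq_of_lt (by omega)
    have e2 : (L - 1 + 1) % (L + 1) = L := by rw [show L - 1 + 1 = L by omega]; exact Nat.mod_eq_of_lt (by omega)
    rw [e1, e2]; rw [Nat.cast_sub hL]; push_cast; ring
  have hs2 : leafStep (layered δ L) (L - 1 + 1) = -(δ * L) := by
    unfold leafStep layered
    have e2 : (L - 1 + 1) % (L + 1) = L := by rw [show L - 1 + 1 = L by omega]; exact Nat.mod_eq_of_lt (by omega)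
    have e3 : (L - 1 + 1 + 1) % (L + 1) = 0 := by rw [show L - 1 + 1 + 1 = L + 1 by omega]; exact Nat.mod_self _
    rw [e2, e3]; push_cast; ring
  rw [hs1, hs2] at hj
  have hpos : 0 < δ * L + δ := by
    have : (1 : ℝ) ≤ L := by exact_mod_cast hL
    nlinarith
  have : |-(δ * ↑L) - δ| = δ * L + δ := by
    rw [show -(δ * (L : ℝ)) - δ = -(δ * L + δ) by ring, abs_neg, abs_of_pos hpos]
  rw [this] at hj
  have : (0 : ℝ) ≤ δ * L := by positivity
  linarith

/-- The layered configuration defeats the fat block as soon as the block height `Lδ` stays below `us`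
and `N` is large — the structure of the eroding steady states of §24.20. -/
theorem layered_no_fatBlock {us δ : ℝ} (hδ : 0 < δ) {L : ℕ} (hL : 1 ≤ L) (hsmall : δ * L < us)
    {N : ℕ} (hNL : L + 1 ≤ N) (hN : 2 * (⌈2 * us / δ⌉₊ : ℕ) < N + 1) :
    OffWindow (layered δ L) N us δ ∧ (∀ j, |layered δ L j| < us) ∧
      ¬ NoWindowJump (layered δ L) N δ ∧ ¬ FatBlock (layered δ L) N us δ := by
  have hsm : ∀ j, |layered δ L j| < us := fun j => lt_of_le_of_lt (layered_abs_le hδ.le L j) hsmall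
  exact ⟨layered_offWindow δ us hL hδ.le N, hsm, layered_windowJump hδ hL hNL, no_fatBlock_of_small hsm hN⟩

end Summit.AnomalousDissipation.AnomalousDissipation.Theorems
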